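import Summits.ResolutionOfSingularities.ResolutionOfSingularities.Theorems.CurveChainCutKernels3
import Summits.ResolutionOfSingularities.ResolutionOfSingularities.Theorems.IsoCompanionCutCells
import HarnessLib

/-!
# CurveChainCutCells — decomp-res node «CurveChainCut» (lens-4 g37, critic row 209 CLEARED), tree file 4/4 of the node

Content VERBATIM from the decomp-res lens-4 g37 node `HOME/decomp-res-lens-4/g37/CurveChainCut.lean` (pin 33fe29d0;
no carry, imports the landed tree only; namespace `…Theorems.HugValuationCut`); HOME =
run/shared/lean/pub/decomp-res; critic CRITIC-LEDGER row 209 CLEARED; landing orders INBOX 10:47:47Z / :1401 —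
provenance, critic text and the lens header in full in the first file of the node, `CurveChainCutKernels`.  `--kind
proof --supports stmt-ResolutionOfSingularities-28338`.

## This file

§120 (g37 · NEW) THE CELLS OF THE CUT OF THE CORE C₃♮ʳ BY THE CURVE LETTER, BY NAME (cn26), AND THE RE-LOCATIONS
(`section CurveCells`): the terminate-predicates / `NoWild…Towers` classes of C₃♮ʳ ∧ (CF∞) (DECIDED — EMPTY,
hyp-free, port-free: `wildOccultDivisorialThreefoldNonLineRecurrentCompanionCurveBoundMixed_holds`,
`wildThreefoldCurveBound_holds`) and C₃♮ʳ ∧ ¬(CF∞) (UNDECIDED · IDEA-NEEDED: the curve-free ruled-recurrent core,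
`not_followsCurveTower_iff`), the split of C₃♮ʳ by excluded middle on the letter, THE LOCATED RESIDUAL after g37
**`NoWildOccultCurveFreeRecurrentCompanionNonLineMixedTowers`** = (C₃♮ʳ ∧ ¬CF∞) ∧ C₄ ∧ D₄ (cone-free HOME is this
file), the exact re-locations `…_iff_g37` (hyp-free) and `…_iff_g37_of_port` of C₃♮, C₃, C and of the g35 / g34 /
g33 / g32 / g31 residuals (inherited binder `(h640 : SurfaceChainPort)`), down-links hyp-free, up-link to g36
hyp-free.  Imports `CurveChainCutKernels3` + `IsoCompanionCutCells`.

[WRITER NOTE (decomp-res writer g13): file split only, at the node's own `══ FILE` markers and `section` boundaries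
(tree files ≤ 400 lines); namespace, sections, section variables and every declaration exactly as in the lens; the
node's two `set_option linter.…` lines, `noncomputable section`, the namespace-level `open` lines and `universe u`
are replayed in every part (critic rider).]

(Sources: Kollar2007 §1.4 (Alg. 1.100, Thm. 1.101); CossartPiltant2008 Lemma 4.3 (3), Prop. 4.4; Matsumura1987 Thms.
14.2, 14.3, 17.8, 32.4; CossartJannsenSaito2020 §6; Hironaka1964 Ch. III; Hauser2010Kangaroo; StacksProject 07PJ / 0C4N / 032E.)
-/

set_option linter.dupNamespace false
set_option linter.unusedSectionVars false

noncomputable section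

open CategoryTheory AlgebraicGeometry IsLocalRing TopologicalSpace
open Literature.AlgebraicGeometry.Resolution
open Summit.ResolutionOfSingularities.ResolutionOfSingularities.Theorems
open WeakOrderReduction ForcedTowerClasses DivergentTowerClasses MonomialTowerClasses
open HugDimensionClasses HugDimensionKernels SurfaceShadowClasses SurfaceShadowKernels
open NearPointCut (SingularClass)
open Scheme.IdealSheafData (vanishingIdeal)
open scoped BigOperators

universe u

namespace Summit.ResolutionOfSingularities.ResolutionOfSingularities.Theorems.HugValuationCut

section CurveCells

/-! ## ══ FILE B `Theorems/CurveChainCutCells.lean` (§120; cone-free; imports FILE A + `IsoCompanionCutCells`) ══ -/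

/-! ## §120 (g37 · NEW) THE CELLS OF THE CUT OF THE CORE C₃♮ʳ BY THE CURVE LETTER, BY NAME, AND THE RE-LOCATIONS

CELL C₃♮ʳ (g36, «the ruled-recurrent occult divisorial threefold tower following no line») = C₃♮ʳᶜ ∧ C₃♮ʳᶠ EXACTLY
(excluded middle on `FollowsCurveTower`): C₃♮ʳᶜ («… that FOLLOWS A CURVE GERM from some stage on») DECIDED — EMPTY,
HYPOTHESIS-FREE and PORT-FREE, for every `p ∣ n` (indeed every `p`), every field, REGULAR AND SINGULAR germs alike
(§119c `noTower_threefold_followsCurve`: δ-descent + line bridge + the g35 line-following law); C₃♮ʳᶠ («… that LEAVES EVERY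
CURVE GERM»: for every stage `m` and every curve chain `(𝔮_i)_{i ≥ m}` some later point `x_{i+1}` is OFF the strict
transform of `𝔮_i`) UNDECIDED · IDEA-NEEDED — THE CURVE-FREE RULED-RECURRENT CORE, the located residual core after g37
(it contains the weight-recurrent «kangaroo» towers (E-rec) and those (N∞)-towers whose near locus is recurrently a union
of curves through the point but which hop between the curves; no law on record; no certified inhabitant — the §0 desk
(d3) small families all die, desk/DESK-g37.md).  Re-locations: HYPOTHESIS-FREE C₃♮ʳ ⟺ C₃♮ʳᶠ and the g36 located residual
⟺ (C₃♮ʳᶠ ∧ C₄) ∧ D₄ =: `NoWildOccultCurveFreeRecurrentCompanionNonLineMixedTowers` (THE LOCATED RESIDUAL after g37);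
MODULO THE PORT `h640` (carried explicitly, inherited from g36/g35, never used by the new law): C₃♮ ⟺ C₃♮ʳᶠ, C₃ ⟺ C₃♮ʳᶠ,
C ⟺ C₃♮ʳᶠ ∧ C₄, the g35/g34/g33 residuals ⟺ the g37 residual, the g32/g31 residuals ⟺ B ∧ the g37 residual. -/

/-- **CELL C₃♮ʳᶜ (ruled-recurrent occult divisorial threefold, follows no line, FOLLOWS A CURVE GERM)** — DECIDED: EMPTY,
HYPOTHESIS-FREE, PORT-FREE (`…CurveBoundMixed_holds`). -/
def WildOccultDivisorialThreefoldNonLineRecurrentCompanionCurveBoundMixedWallFreeFreshJumpShallowCompanionKangarooTowersTerminate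
    (n : ℕ) : Prop :=
  NoTowerWild n fun T => ((((((MixedResidual n T ∧ ¬ (LatentFactorTower T ∧ ThreefoldTower T)) ∧ ¬ LatentFactorTower T) ∧
    DivisorialTower T) ∧ ThreefoldTower T) ∧ ¬ FollowsLineTower T) ∧ ¬ IsolatedCompanionTower T) ∧ FollowsCurveTower T

/-- **CELL C₃♮ʳᶠ (ruled-recurrent occult divisorial threefold, follows no line, LEAVES EVERY CURVE GERM) · THE LOCATED
RESIDUAL CORE after g37 — «THE CURVE-FREE RULED-RECURRENT OCCULT THREEFOLD TOWER»** — UNDECIDED · IDEA-NEEDED (no law on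
record; no certified inhabitant). -/
def WildOccultDivisorialThreefoldNonLineRecurrentCompanionCurveFreeMixedWallFreeFreshJumpShallowCompanionKangarooTowersTerminate
    (n : ℕ) : Prop :=
  NoTowerWild n fun T => ((((((MixedResidual n T ∧ ¬ (LatentFactorTower T ∧ ThreefoldTower T)) ∧ ¬ LatentFactorTower T) ∧
    DivisorialTower T) ∧ ThreefoldTower T) ∧ ¬ FollowsLineTower T) ∧ ¬ IsolatedCompanionTower T) ∧ ¬ FollowsCurveTower T

/-- **EXACT (pure logic): CELL C₃♮ʳ = C₃♮ʳᶜ ∧ C₃♮ʳᶠ.** [folklore] -/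
theorem wildOccultDivisorialThreefoldNonLineRecurrentCompanionMixed_split (n : ℕ) :
    WildOccultDivisorialThreefoldNonLineRecurrentCompanionMixedWallFreeFreshJumpShallowCompanionKangarooTowersTerminate n ↔
      WildOccultDivisorialThreefoldNonLineRecurrentCompanionCurveBoundMixedWallFreeFreshJumpShallowCompanionKangarooTowersTerminate
          n ∧
        WildOccultDivisorialThreefoldNonLineRecurrentCompanionCurveFreeMixedWallFreeFreshJumpShallowCompanionKangarooTowersTerminate
          n :=
  noTowerWild_split _ FollowsCurveTower

/-- **CELL C₃♮ʳᶜ IS EMPTY — HYPOTHESIS-FREE, PORT-FREE (every `n`).** [folklore] -/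
theorem wildOccultDivisorialThreefoldNonLineRecurrentCompanionCurveBoundMixed_holds (n : ℕ) :
    WildOccultDivisorialThreefoldNonLineRecurrentCompanionCurveBoundMixedWallFreeFreshJumpShallowCompanionKangarooTowersTerminate
      n :=
  noTowerWild_mono (fun _ h => ⟨h.1, h.1.1.1.2, h.2⟩) (noTowerWild_threefold_followsCurve n fun T =>
    (((((MixedResidual n T ∧ ¬ (LatentFactorTower T ∧ ThreefoldTower T)) ∧ ¬ LatentFactorTower T) ∧
    DivisorialTower T) ∧ ThreefoldTower T) ∧ ¬ FollowsLineTower T) ∧ ¬ IsolatedCompanionTower T)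

/-- **THE CURVE LETTER KILLED IN THE WHOLE rd-3 COLUMN (class-general, HYPOTHESIS-FREE, PORT-FREE)**: for ANY class `P`, no
wild forced threefold tower of class `P` follows a curve germ. [folklore] -/
theorem wildThreefoldCurveBound_holds (n : ℕ) (P : ForcedTower → Prop) :
    NoTowerWild n fun T => (P T ∧ ThreefoldTower T) ∧ FollowsCurveTower T :=
  noTowerWild_mono (fun _ h => ⟨h.1.1, h.1.2, h.2⟩) (noTowerWild_threefold_followsCurve n P)

/-- **EXACT RE-LOCATION OF CELL C₃♮ʳ, HYPOTHESIS-FREE: C₃♮ʳ ⟺ C₃♮ʳᶠ.** [folklore] -/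
theorem wildOccultDivisorialThreefoldNonLineRecurrentCompanionMixed_iff_g37 (n : ℕ) :
    WildOccultDivisorialThreefoldNonLineRecurrentCompanionMixedWallFreeFreshJumpShallowCompanionKangarooTowersTerminate n ↔
      WildOccultDivisorialThreefoldNonLineRecurrentCompanionCurveFreeMixedWallFreeFreshJumpShallowCompanionKangarooTowersTerminate
        n :=
  (wildOccultDivisorialThreefoldNonLineRecurrentCompanionMixed_split n).trans
    ⟨fun h => h.2, fun h => ⟨wildOccultDivisorialThreefoldNonLineRecurrentCompanionCurveBoundMixed_holds n, h⟩⟩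

/-- down-link, HYPOTHESIS-FREE: C₃♮ʳ ⟹ C₃♮ʳᶠ. [folklore] -/
theorem wildOccultDivisorialThreefoldNonLineRecurrentCompanionCurveFreeMixed_of_recurrentCompanion {n : ℕ}
    (h : WildOccultDivisorialThreefoldNonLineRecurrentCompanionMixedWallFreeFreshJumpShallowCompanionKangarooTowersTerminate n) :
    WildOccultDivisorialThreefoldNonLineRecurrentCompanionCurveFreeMixedWallFreeFreshJumpShallowCompanionKangarooTowersTerminate
      n :=
  ((wildOccultDivisorialThreefoldNonLineRecurrentCompanionMixed_split n).mp h).2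

/-- **EXACT RE-LOCATION OF CELL C₃♮ MODULO THE PORT: C₃♮ ⟺ C₃♮ʳᶠ.** [folklore] -/
theorem wildOccultDivisorialThreefoldNonLineMixed_iff_g37_of_port (h640 : SurfaceChainPort) (n : ℕ) :
    WildOccultDivisorialThreefoldNonLineMixedWallFreeFreshJumpShallowCompanionKangarooTowersTerminate n ↔
      WildOccultDivisorialThreefoldNonLineRecurrentCompanionCurveFreeMixedWallFreeFreshJumpShallowCompanionKangarooTowersTerminate
        n :=
  (wildOccultDivisorialThreefoldNonLineMixed_iff_g36_of_port h640 n).trans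
    (wildOccultDivisorialThreefoldNonLineRecurrentCompanionMixed_iff_g37 n)

/-- **EXACT RE-LOCATION OF CELL C₃ MODULO THE PORT: C₃ ⟺ C₃♮ʳᶠ.** [folklore] -/
theorem wildOccultDivisorialThreefoldMixed_iff_g37_of_port (h640 : SurfaceChainPort) (n : ℕ) :
    WildOccultDivisorialThreefoldMixedWallFreeFreshJumpShallowCompanionKangarooTowersTerminate n ↔
      WildOccultDivisorialThreefoldNonLineRecurrentCompanionCurveFreeMixedWallFreeFreshJumpShallowCompanionKangarooTowersTerminate
        n :=
  (wildOccultDivisorialThreefoldMixed_iff_g36_of_port h640 n).trans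
    (wildOccultDivisorialThreefoldNonLineRecurrentCompanionMixed_iff_g37 n)

/-- **EXACT RE-LOCATION OF CELL C MODULO THE PORT: C ⟺ C₃♮ʳᶠ ∧ C₄.** [folklore] -/
theorem wildOccultDivisorialMixed_iff_g37_of_port (h640 : SurfaceChainPort) (n : ℕ) :
    WildOccultDivisorialMixedWallFreeFreshJumpShallowCompanionKangarooTowersTerminate n ↔
      WildOccultDivisorialThreefoldNonLineRecurrentCompanionCurveFreeMixedWallFreeFreshJumpShallowCompanionKangarooTowersTerminate
          n ∧
        WildOccultDivisorialNonThreefoldMixedWallFreeFreshJumpShallowCompanionKangarooTowersTerminate n :=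
  (wildOccultDivisorialMixed_iff_g36_of_port h640 n).trans
    (Iff.and (wildOccultDivisorialThreefoldNonLineRecurrentCompanionMixed_iff_g37 n) Iff.rfl)

/-- **THE CURVE LETTER UNFOLDED (kernel, pure logic)**: a tower LEAVES EVERY CURVE GERM iff for every stage `m` and every
curve chain of non-maximal primes compatible under the stalk maps from `m` on, the followed germ at `m` is NOT of dimension
one. [folklore] -/
theorem not_followsCurveTower_iff (T : ForcedTower) :
    ¬ FollowsCurveTower T ↔ ∀ (m : ℕ) (𝔮 : ∀ i, Ideal (lineRing T i 0)),
      (∀ i, m ≤ i → (𝔮 i).IsPrime ∧ 𝔮 i ≠ maximalIdeal (lineRing T i 0) ∧ (𝔮 (i + 1)).comap (lineMap T i 0) = 𝔮 i) →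
        ringKrullDim (lineRing T m 0 ⧸ 𝔮 m) ≠ 1 := by
  simp only [FollowsCurveTower, not_exists, not_and]

/-- BY NAME: **no wild ruled-recurrent occult divisorial threefold tower following no line THAT FOLLOWS A CURVE GERM** (CELL
C₃♮ʳᶜ; DECIDED, HYPOTHESIS-FREE, PORT-FREE). -/
def NoWildOccultDivisorialThreefoldNonLineRecurrentCompanionCurveBoundMixedTowers : Prop :=
  ∀ n : ℕ, 1 ≤ n →
    WildOccultDivisorialThreefoldNonLineRecurrentCompanionCurveBoundMixedWallFreeFreshJumpShallowCompanionKangarooTowersTerminate n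

/-- BY NAME: **no wild CURVE-FREE ruled-recurrent occult divisorial threefold tower** (CELL C₃♮ʳᶠ; UNDECIDED — the located
residual core after g37). -/
def NoWildOccultDivisorialThreefoldNonLineRecurrentCompanionCurveFreeMixedTowers : Prop :=
  ∀ n : ℕ, 1 ≤ n →
    WildOccultDivisorialThreefoldNonLineRecurrentCompanionCurveFreeMixedWallFreeFreshJumpShallowCompanionKangarooTowersTerminate n

/-- BY NAME: **THE LOCATED RESIDUAL of the lens-4 NP column after g37 — «no wild occult mixed tower that (is a curve-free
ruled-recurrent divisorial threefold following no line) or is not a threefold»** = (C₃♮ʳᶠ ∧ C₄) ∧ D₄. -/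
def NoWildOccultCurveFreeRecurrentCompanionNonLineMixedTowers : Prop :=
  (NoWildOccultDivisorialThreefoldNonLineRecurrentCompanionCurveFreeMixedTowers ∧ NoWildOccultDivisorialNonThreefoldMixedTowers) ∧
    NoWildOccultNonDivisorialNonThreefoldMixedTowers

/-- **CELL C₃♮ʳᶜ DECIDED BY NAME — HYPOTHESIS-FREE, PORT-FREE.** [folklore] -/
theorem noWildOccultDivisorialThreefoldNonLineRecurrentCompanionCurveBoundMixedTowers_holds :
    NoWildOccultDivisorialThreefoldNonLineRecurrentCompanionCurveBoundMixedTowers := fun n _ =>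
  wildOccultDivisorialThreefoldNonLineRecurrentCompanionCurveBoundMixed_holds n

/-- **EXACT RE-LOCATION BY NAME, HYPOTHESIS-FREE: CELL C₃♮ʳ ⟺ CELL C₃♮ʳᶠ.** [folklore] -/
theorem noWildOccultDivisorialThreefoldNonLineRecurrentCompanionMixedTowers_iff_g37 :
    NoWildOccultDivisorialThreefoldNonLineRecurrentCompanionMixedTowers ↔
      NoWildOccultDivisorialThreefoldNonLineRecurrentCompanionCurveFreeMixedTowers :=
  ⟨fun h n hn => (wildOccultDivisorialThreefoldNonLineRecurrentCompanionMixed_iff_g37 n).mp (h n hn),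
    fun h n hn => (wildOccultDivisorialThreefoldNonLineRecurrentCompanionMixed_iff_g37 n).mpr (h n hn)⟩

/-- **EXACT RE-LOCATION BY NAME, HYPOTHESIS-FREE: the g36 located residual ⟺ the g37 located residual.** [folklore] -/
theorem noWildOccultRecurrentCompanionNonLineMixedTowers_iff_g37 :
    NoWildOccultRecurrentCompanionNonLineMixedTowers ↔ NoWildOccultCurveFreeRecurrentCompanionNonLineMixedTowers :=
  Iff.and (Iff.and noWildOccultDivisorialThreefoldNonLineRecurrentCompanionMixedTowers_iff_g37 Iff.rfl) Iff.rfl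

/-- **EXACT RE-LOCATION BY NAME, MODULO THE PORT: CELL C₃♮ ⟺ CELL C₃♮ʳᶠ.** [folklore] -/
theorem noWildOccultDivisorialThreefoldNonLineMixedTowers_iff_g37_of_port (h640 : SurfaceChainPort) :
    NoWildOccultDivisorialThreefoldNonLineMixedTowers ↔
      NoWildOccultDivisorialThreefoldNonLineRecurrentCompanionCurveFreeMixedTowers :=
  (noWildOccultDivisorialThreefoldNonLineMixedTowers_iff_g36_of_port h640).trans
    noWildOccultDivisorialThreefoldNonLineRecurrentCompanionMixedTowers_iff_g37

/-- **EXACT RE-LOCATION BY NAME, MODULO THE PORT: CELL C₃ ⟺ CELL C₃♮ʳᶠ.** [folklore] -/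
theorem noWildOccultDivisorialThreefoldMixedTowers_iff_g37_of_port (h640 : SurfaceChainPort) :
    NoWildOccultDivisorialThreefoldMixedTowers ↔ NoWildOccultDivisorialThreefoldNonLineRecurrentCompanionCurveFreeMixedTowers :=
  (noWildOccultDivisorialThreefoldMixedTowers_iff_g36_of_port h640).trans
    noWildOccultDivisorialThreefoldNonLineRecurrentCompanionMixedTowers_iff_g37

/-- **EXACT RE-LOCATION BY NAME, MODULO THE PORT: the g35 located residual ⟺ the g37 located residual.** [folklore] -/
theorem noWildOccultNonLineMixedTowers_iff_g37_of_port (h640 : SurfaceChainPort) :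
    NoWildOccultNonLineMixedTowers ↔ NoWildOccultCurveFreeRecurrentCompanionNonLineMixedTowers :=
  (noWildOccultNonLineMixedTowers_iff_g36_of_port h640).trans noWildOccultRecurrentCompanionNonLineMixedTowers_iff_g37

/-- **EXACT RE-LOCATION BY NAME, MODULO THE PORT: the g34 located residual (= C ∧ D₄) ⟺ the g37 located residual.**
[folklore] -/
theorem noWildOccultDivisorialOrNonThreefoldMixedTowers_iff_g37_of_port (h640 : SurfaceChainPort) :
    NoWildOccultDivisorialOrNonThreefoldMixedTowers ↔ NoWildOccultCurveFreeRecurrentCompanionNonLineMixedTowers :=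
  (noWildOccultDivisorialOrNonThreefoldMixedTowers_iff_g36_of_port h640).trans
    noWildOccultRecurrentCompanionNonLineMixedTowers_iff_g37

/-- **EXACT RE-LOCATION BY NAME, MODULO THE PORT: the g33 occult residual (= C ∧ D) ⟺ the g37 located residual.** [folklore] -/
theorem noWildOccultMixedTowers_iff_g37_of_port (h640 : SurfaceChainPort) :
    NoWildOccultMixedTowers ↔ NoWildOccultCurveFreeRecurrentCompanionNonLineMixedTowers :=
  (noWildOccultMixedTowers_iff_g36_of_port h640).trans noWildOccultRecurrentCompanionNonLineMixedTowers_iff_g37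

/-- **EXACT RE-LOCATION BY NAME, MODULO THE PORT: the g32 residual ⟺ CELL B ∧ the g37 located residual.** [folklore] -/
theorem noWildMixedWallFreeFreshJumpShallowCompanionKangarooTowers_iff_g37_of_port (h640 : SurfaceChainPort) :
    NoWildMixedWallFreeFreshJumpShallowCompanionKangarooTowers ↔
      NoWildLatentFactorNonThreefoldMixedTowers ∧ NoWildOccultCurveFreeRecurrentCompanionNonLineMixedTowers :=
  (noWildMixedWallFreeFreshJumpShallowCompanionKangarooTowers_iff_g36_of_port h640).trans
    (Iff.and Iff.rfl noWildOccultRecurrentCompanionNonLineMixedTowers_iff_g37)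

/-- **EXACT RE-LOCATION BY NAME, MODULO THE PORT: the g31 residual ⟺ CELL B ∧ the g37 located residual.** [folklore] -/
theorem noWildNonSurfaceWallFreeFreshJumpShallowCompanionKangarooTowers_iff_g37_of_port (h640 : SurfaceChainPort) :
    NoWildNonSurfaceWallFreeFreshJumpShallowCompanionKangarooTowers ↔
      NoWildLatentFactorNonThreefoldMixedTowers ∧ NoWildOccultCurveFreeRecurrentCompanionNonLineMixedTowers :=
  (noWildNonSurfaceWallFreeFreshJumpShallowCompanionKangarooTowers_iff_g36_of_port h640).trans
    (Iff.and Iff.rfl noWildOccultRecurrentCompanionNonLineMixedTowers_iff_g37)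

/-- down-link (HYPOTHESIS-FREE): the g37 located residual ⟸ the g36 located residual. [folklore] -/
theorem noWildOccultCurveFreeRecurrentCompanionNonLineMixedTowers_of_g36 (h : NoWildOccultRecurrentCompanionNonLineMixedTowers) :
    NoWildOccultCurveFreeRecurrentCompanionNonLineMixedTowers :=
  noWildOccultRecurrentCompanionNonLineMixedTowers_iff_g37.mp h

/-- down-link (HYPOTHESIS-FREE): the g37 located residual ⟸ the g35 located residual. [folklore] -/
theorem noWildOccultCurveFreeRecurrentCompanionNonLineMixedTowers_of_g35 (h : NoWildOccultNonLineMixedTowers) :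
    NoWildOccultCurveFreeRecurrentCompanionNonLineMixedTowers :=
  noWildOccultCurveFreeRecurrentCompanionNonLineMixedTowers_of_g36 (noWildOccultRecurrentCompanionNonLineMixedTowers_of_g35 h)

/-- down-link (HYPOTHESIS-FREE): the g37 located residual ⟸ the g34 located residual. [folklore] -/
theorem noWildOccultCurveFreeRecurrentCompanionNonLineMixedTowers_of_g34 (h : NoWildOccultDivisorialOrNonThreefoldMixedTowers) :
    NoWildOccultCurveFreeRecurrentCompanionNonLineMixedTowers :=
  noWildOccultCurveFreeRecurrentCompanionNonLineMixedTowers_of_g36 (noWildOccultRecurrentCompanionNonLineMixedTowers_of_g34 h)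

/-- down-link (HYPOTHESIS-FREE): the g37 located residual ⟸ the g32 residual. [folklore] -/
theorem noWildOccultCurveFreeRecurrentCompanionNonLineMixedTowers_of_g32
    (h : NoWildMixedWallFreeFreshJumpShallowCompanionKangarooTowers) :
    NoWildOccultCurveFreeRecurrentCompanionNonLineMixedTowers :=
  noWildOccultCurveFreeRecurrentCompanionNonLineMixedTowers_of_g36 (noWildOccultRecurrentCompanionNonLineMixedTowers_of_g32 h)

/-- down-link from the TREE aside `NoWildContactFreeOffLocusTowers` (HYPOTHESIS-FREE). [folklore] -/
theorem noWildOccultCurveFreeRecurrentCompanionNonLineMixedTowers_of_aside (h : NoWildContactFreeOffLocusTowers) :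
    NoWildOccultCurveFreeRecurrentCompanionNonLineMixedTowers :=
  noWildOccultCurveFreeRecurrentCompanionNonLineMixedTowers_of_g36 (noWildOccultRecurrentCompanionNonLineMixedTowers_of_aside h)

/-- up-link (HYPOTHESIS-FREE): the g36 located residual ⟸ the g37 located residual. [folklore] -/
theorem noWildOccultRecurrentCompanionNonLineMixedTowers_of_g37 (h : NoWildOccultCurveFreeRecurrentCompanionNonLineMixedTowers) :
    NoWildOccultRecurrentCompanionNonLineMixedTowers :=
  noWildOccultRecurrentCompanionNonLineMixedTowers_iff_g37.mpr h

/-- up-link MODULO THE PORT: the g35 located residual ⟸ the g37 located residual. [folklore] -/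
theorem noWildOccultNonLineMixedTowers_of_g37_of_port (h640 : SurfaceChainPort)
    (h : NoWildOccultCurveFreeRecurrentCompanionNonLineMixedTowers) : NoWildOccultNonLineMixedTowers :=
  noWildOccultNonLineMixedTowers_of_g36_of_port h640 (noWildOccultRecurrentCompanionNonLineMixedTowers_of_g37 h)

end CurveCells

end Summit.ResolutionOfSingularities.ResolutionOfSingularities.Theorems.HugValuationCut
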